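import Summits.QuantumFields.GaugeBoot.PolynomialObservables
import Summits.QuantumFields.GaugeBoot.AdInvariantSchwingerDysonRows
import Summits.QuantumFields.GaugeBoot.DiagonalRPTorusHexObservable
import HarnessLib

/-!
# Wilson lines and Wilson loops along lattice words as polynomial observables (gauge-boot, L1 supplement)

HONEST FRAMING (cell `pub-gaugeboot`, page 1 of every file): the venture produces certified bounds
on lattice expectations at stated coupling, gauge group, dimension and torus size; NOT a mass gap,
NOT a continuum limit, NOT a string tension; NOT Yang–Mills-summit-bearing (barriers
`FixedCouplingUltralocality`, `PerturbativeInvisibility`). Structural; it certifies no number.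

## Content

Bookkeeping for `WilsonLineGramPositivity.lean` (the loop-positivity matrices of the bootstrap on
gauge-invariant data). For a unitary lattice representation `r` (`LatticeRep`), a base site `x` and
a lattice word `w` (`LatticeWords`) on the torus `(ℤ/L)^d`:

* `entriesPoly_wordHolonomy` — the matrix `ρ(hol_x(w))` of an (open) Wilson LINE has polynomial
  entries; `lineRe` / `lineIm r x w a b` — the real and imaginary parts of its `(a,b)` entry as
  continuous observables, in `polyAlgebra r` (`lineRe_mem`, `lineIm_mem`); `lineCombRe` /
  `lineCombIm` — real and imaginary part of an open-string combination `Σ_j c_j ρ(hol_x(p_j))_{ab}`;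
* `loopRe` / `loopIm r x w` — real and imaginary parts of the Wilson LOOP `tr ρ(hol_x(w))`, in
  `polyAlgebra r`; gauge invariant for closed `w` (`isGaugeInvariant_loopRe` / `_loopIm`);
* `rho_wordHolonomy_gaugeTransform` — covariance `ρ(hol_x(w)(U^γ)) = ρ(γ x) ρ(hol_x(w) U) ρ(γ y)⁻¹`
  (`y` the endpoint; from `DiagRPHex.wordHolonomy_gaugeTransform`);
* `rho_wordHolonomy_append_reverse` — for two words `p`, `q` from `x` with the same endpoint,
  `ρ(hol_x(p · q̄)) = ρ(hol_x p) ρ(hol_x q)ᴴ`; hence the Hermitian symmetry of the loop matrix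
  `W_{jk} = tr ρ(hol(p_j · p̄_k))`: `loopRe_swap`, `loopIm_swap`.

Elementary; no named fact.
-/

noncomputable section

open MeasureTheory
open scoped ComplexConjugate Matrix
open Literature.MathematicalPhysics.QuantumFieldTheory (Site Edge GaugeConfig gaugeTransform
  IsGaugeInvariant LatticeRep)

namespace Summit.QuantumFields.GaugeBoot

variable {d L : ℕ} {G : Type*} [Group G] [TopologicalSpace G] (r : LatticeRep G)

/-! ## Words: closing two lines with the same endpoints into a loop -/

section Words

omit [TopologicalSpace G] in
/-- `hol_x(p · q̄) = hol_x(p) · hol_x(q)⁻¹` for two words from `x` with the same endpoint. -/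
theorem wordHolonomy_append_reverse_of_endpoint_eq (U : GaugeConfig d L G) (x : Site d L)
    {p q : Word d} (h : Word.endpoint x p = Word.endpoint x q) :
    wordHolonomy U x (p ++ q.reverse) = wordHolonomy U x p * (wordHolonomy U x q)⁻¹ := by
  rw [wordHolonomy_append, h, wordHolonomy_reverse]

/-- `p · q̄` is a closed word at `x`. -/
theorem endpoint_append_reverse_of_endpoint_eq (x : Site d L) {p q : Word d}
    (h : Word.endpoint x p = Word.endpoint x q) : Word.endpoint x (p ++ q.reverse) = x := by
  rw [Word.endpoint_append, h, Word.endpoint_reverse]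

/-- ★ `ρ(hol_x(p · q̄)) = ρ(hol_x p) · ρ(hol_x q)ᴴ` for two words from `x` with the same endpoint. -/
theorem rho_wordHolonomy_append_reverse (U : GaugeConfig d L G) (x : Site d L) {p q : Word d}
    (h : Word.endpoint x p = Word.endpoint x q) :
    r.ρ (wordHolonomy U x (p ++ q.reverse)) =
      r.ρ (wordHolonomy U x p) * (r.ρ (wordHolonomy U x q))ᴴ := by
  -- unitarity `ρ(g⁻¹) = ρ(g)ᴴ` (tree `rho_inv_apply`, entrywise)
  have hinv : ∀ g : G, r.ρ g⁻¹ = (r.ρ g)ᴴ := fun g =>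
    Matrix.ext fun a b => by rw [rho_inv_apply, Matrix.conjTranspose_apply, Complex.star_def]
  rw [wordHolonomy_append_reverse_of_endpoint_eq U x h, map_mul, hinv]

/-- **Hermitian symmetry of the loop matrix**: `tr ρ(hol_x(q · p̄)) = conj tr ρ(hol_x(p · q̄))`. -/
theorem trace_rho_wordHolonomy_swap (U : GaugeConfig d L G) (x : Site d L) {p q : Word d}
    (h : Word.endpoint x p = Word.endpoint x q) :
    (r.ρ (wordHolonomy U x (q ++ p.reverse))).trace =
      conj (r.ρ (wordHolonomy U x (p ++ q.reverse))).trace := by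
  rw [wordHolonomy_append_reverse_of_endpoint_eq U x h,
    wordHolonomy_append_reverse_of_endpoint_eq U x h.symm,
    show wordHolonomy U x q * (wordHolonomy U x p)⁻¹ =
      (wordHolonomy U x p * (wordHolonomy U x q)⁻¹)⁻¹ by rw [mul_inv_rev, inv_inv]]
  have hinv : ∀ g : G, r.ρ g⁻¹ = (r.ρ g)ᴴ := fun g =>
    Matrix.ext fun a b => by rw [rho_inv_apply, Matrix.conjTranspose_apply, Complex.star_def]
  rw [hinv, Matrix.trace_conjTranspose, Complex.star_def]

/-- **Gauge covariance of Wilson lines**: `ρ(hol_x(w)(U^γ)) = ρ(γ x) ρ(hol_x(w) U) ρ(γ y)⁻¹`, `y`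
the endpoint of `w`. -/
theorem rho_wordHolonomy_gaugeTransform (γ : Site d L → G) (U : GaugeConfig d L G) (x : Site d L)
    (w : Word d) : r.ρ (wordHolonomy (gaugeTransform γ U) x w) =
      r.ρ (γ x) * r.ρ (wordHolonomy U x w) * r.ρ (γ (Word.endpoint x w))⁻¹ := by
  rw [DiagRPHex.wordHolonomy_gaugeTransform γ U x w, map_mul, map_mul]

/-- **Wilson loops are gauge invariant**: the trace of the holonomy of a CLOSED word. -/
theorem trace_rho_wordHolonomy_gaugeTransform (γ : Site d L → G) (U : GaugeConfig d L G)
    (x : Site d L) {w : Word d} (hw : Word.endpoint x w = x) :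
    (r.ρ (wordHolonomy (gaugeTransform γ U) x w)).trace = (r.ρ (wordHolonomy U x w)).trace := by
  rw [rho_wordHolonomy_gaugeTransform, hw, Matrix.trace_mul_cycle, ← map_mul, inv_mul_cancel, map_one,
    one_mul]

end Words

/-! ## Polynomiality and continuity -/

section Poly

variable [IsTopologicalGroup G]

/-- `U ↦ ρ(hol_x(w) U)` is continuous. -/
theorem continuous_rho_wordHolonomy (x : Site d L) (w : Word d) :
    Continuous fun U : GaugeConfig d L G => r.ρ (wordHolonomy U x w) := by
  refine r.continuous.comp ?_
  induction w generalizing x with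
  | nil => simpa using continuous_const
  | cons s w ih =>
    simp only [wordHolonomy_cons]
    refine Continuous.mul ?_ (ih (s.apply x))
    cases s with
    | fwd μ => exact continuous_apply _
    | bwd μ => exact (continuous_apply _).inv

omit [IsTopologicalGroup G] in
/-- ★ **Wilson lines have polynomial entries**: `EntriesPoly r (ρ ∘ hol_x(w))`. -/
theorem entriesPoly_wordHolonomy (x : Site d L) (w : Word d) :
    EntriesPoly r (fun U : GaugeConfig d L G => r.ρ (wordHolonomy U x w)) := by
  induction w generalizing x with
  | nil =>
    intro a b
    by_cases hab : a = b
    · subst hab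
      simp only [wordHolonomy_nil, map_one, Matrix.one_apply_eq, Complex.one_re, Complex.one_im]
      exact ⟨Subalgebra.one_mem _, Subalgebra.zero_mem _⟩
    · simp only [wordHolonomy_nil, map_one, Matrix.one_apply_ne hab, Complex.zero_re, Complex.zero_im]
      exact ⟨Subalgebra.zero_mem _, Subalgebra.zero_mem _⟩
  | cons s w ih =>
    have hstep : EntriesPoly r (fun U : GaugeConfig d L G => r.ρ (stepHolonomy U x s)) := by
      cases s with
      | fwd μ => simpa using entriesPoly_rho r ((x, μ) : Edge d L)
      | bwd μ => simpa using entriesPoly_rho_inv r ((x - Pi.single μ 1, μ) : Edge d L)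
    have h := hstep.mul r (ih (s.apply x))
    simpa only [wordHolonomy_cons, map_mul] using h

omit [IsTopologicalGroup G] in
/-- The imaginary part of the trace of a matrix-valued polynomial observable is polynomial. -/
theorem EntriesPoly.trace_im {ι : Type*} {M : (ι → G) → Matrix (Fin r.N) (Fin r.N) ℂ}
    (hM : EntriesPoly r M) : (fun U => (M U).trace.im) ∈ polyFunctions (ι := ι) r := by
  have h : (fun U => (M U).trace.im) = ∑ a, fun U => (M U a a).im := by
    funext U
    simp [Matrix.trace, Complex.im_sum, Finset.sum_apply]
  rw [h]
  exact Subalgebra.sum_mem _ fun a _ => (hM a a).2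

/-- **Wilson line entry, real part** `U ↦ Re ρ(hol_x(w) U)_{ab}` as a continuous observable. -/
def lineRe (x : Site d L) (w : Word d) (a b : Fin r.N) : C(GaugeConfig d L G, ℝ) :=
  ⟨fun U => (r.ρ (wordHolonomy U x w) a b).re,
    Complex.continuous_re.comp ((continuous_rho_wordHolonomy r x w).matrix_elem a b)⟩

/-- **Wilson line entry, imaginary part** `U ↦ Im ρ(hol_x(w) U)_{ab}`. -/
def lineIm (x : Site d L) (w : Word d) (a b : Fin r.N) : C(GaugeConfig d L G, ℝ) :=
  ⟨fun U => (r.ρ (wordHolonomy U x w) a b).im,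
    Complex.continuous_im.comp ((continuous_rho_wordHolonomy r x w).matrix_elem a b)⟩

/-- **Wilson loop, real part** `U ↦ Re tr ρ(hol_x(w) U)`. -/
def loopRe (x : Site d L) (w : Word d) : C(GaugeConfig d L G, ℝ) :=
  ⟨fun U => (r.ρ (wordHolonomy U x w)).trace.re,
    Complex.continuous_re.comp (continuous_rho_wordHolonomy r x w).matrix_trace⟩

/-- **Wilson loop, imaginary part** `U ↦ Im tr ρ(hol_x(w) U)`. -/
def loopIm (x : Site d L) (w : Word d) : C(GaugeConfig d L G, ℝ) :=
  ⟨fun U => (r.ρ (wordHolonomy U x w)).trace.im,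
    Complex.continuous_im.comp (continuous_rho_wordHolonomy r x w).matrix_trace⟩

/-- `lineRe` evaluated. -/
@[simp] theorem lineRe_apply (x : Site d L) (w : Word d) (a b : Fin r.N) (U : GaugeConfig d L G) :
    lineRe r x w a b U = (r.ρ (wordHolonomy U x w) a b).re := rfl

/-- `lineIm` evaluated. -/
@[simp] theorem lineIm_apply (x : Site d L) (w : Word d) (a b : Fin r.N) (U : GaugeConfig d L G) :
    lineIm r x w a b U = (r.ρ (wordHolonomy U x w) a b).im := rfl

/-- `loopRe` evaluated. -/
@[simp] theorem loopRe_apply (x : Site d L) (w : Word d) (U : GaugeConfig d L G) :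
    loopRe r x w U = (r.ρ (wordHolonomy U x w)).trace.re := rfl

/-- `loopIm` evaluated. -/
@[simp] theorem loopIm_apply (x : Site d L) (w : Word d) (U : GaugeConfig d L G) :
    loopIm r x w U = (r.ρ (wordHolonomy U x w)).trace.im := rfl

/-- `lineRe ∈ polyAlgebra`. -/
theorem lineRe_mem (x : Site d L) (w : Word d) (a b : Fin r.N) :
    lineRe r x w a b ∈ polyAlgebra (ι := Edge d L) r := by
  obtain ⟨g, hg, hge⟩ := (mem_polyFunctions_iff r).1 ((entriesPoly_wordHolonomy r x w) a b).1
  have e : lineRe r x w a b = g := DFunLike.ext' hge.symm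
  rw [e]
  exact hg

/-- `lineIm ∈ polyAlgebra`. -/
theorem lineIm_mem (x : Site d L) (w : Word d) (a b : Fin r.N) :
    lineIm r x w a b ∈ polyAlgebra (ι := Edge d L) r := by
  obtain ⟨g, hg, hge⟩ := (mem_polyFunctions_iff r).1 ((entriesPoly_wordHolonomy r x w) a b).2
  have e : lineIm r x w a b = g := DFunLike.ext' hge.symm
  rw [e]
  exact hg

/-- `loopRe ∈ polyAlgebra`. -/
theorem loopRe_mem (x : Site d L) (w : Word d) : loopRe r x w ∈ polyAlgebra (ι := Edge d L) r := by
  obtain ⟨g, hg, hge⟩ := (mem_polyFunctions_iff r).1 ((entriesPoly_wordHolonomy r x w).trace_re r)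
  have e : loopRe r x w = g := DFunLike.ext' hge.symm
  rw [e]
  exact hg

/-- `loopIm ∈ polyAlgebra`. -/
theorem loopIm_mem (x : Site d L) (w : Word d) : loopIm r x w ∈ polyAlgebra (ι := Edge d L) r := by
  obtain ⟨g, hg, hge⟩ := (mem_polyFunctions_iff r).1 ((entriesPoly_wordHolonomy r x w).trace_im r)
  have e : loopIm r x w = g := DFunLike.ext' hge.symm
  rw [e]
  exact hg

/-- **Wilson loops of closed words are gauge-invariant observables** (real part). -/
theorem isGaugeInvariant_loopRe (x : Site d L) {w : Word d} (hw : Word.endpoint x w = x) :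
    IsGaugeInvariant (⇑(loopRe r x w) : GaugeConfig d L G → ℝ) := fun γ U => by
  rw [loopRe_apply, loopRe_apply, trace_rho_wordHolonomy_gaugeTransform r γ U x hw]

/-- **Wilson loops of closed words are gauge-invariant observables** (imaginary part). -/
theorem isGaugeInvariant_loopIm (x : Site d L) {w : Word d} (hw : Word.endpoint x w = x) :
    IsGaugeInvariant (⇑(loopIm r x w) : GaugeConfig d L G → ℝ) := fun γ U => by
  rw [loopIm_apply, loopIm_apply, trace_rho_wordHolonomy_gaugeTransform r γ U x hw]

/-- **Hermitian symmetry, real part**: `Re tr ρ(hol(q · p̄)) = Re tr ρ(hol(p · q̄))`. -/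
theorem loopRe_swap (x : Site d L) {p q : Word d} (h : Word.endpoint x p = Word.endpoint x q) :
    loopRe r x (q ++ p.reverse) = (loopRe r x (p ++ q.reverse) : C(GaugeConfig d L G, ℝ)) := by
  ext U
  rw [loopRe_apply, loopRe_apply, trace_rho_wordHolonomy_swap r U x h, Complex.conj_re]

/-- **Hermitian symmetry, imaginary part**: `Im tr ρ(hol(q · p̄)) = - Im tr ρ(hol(p · q̄))`. -/
theorem loopIm_swap (x : Site d L) {p q : Word d} (h : Word.endpoint x p = Word.endpoint x q) :
    loopIm r x (q ++ p.reverse) = -(loopIm r x (p ++ q.reverse) : C(GaugeConfig d L G, ℝ)) := by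
  ext U
  rw [ContinuousMap.neg_apply, loopIm_apply, loopIm_apply, trace_rho_wordHolonomy_swap r U x h,
    Complex.conj_im]

variable {σ : Type*} [Fintype σ]

/-- **Real part of an open-string combination** `Σ_j c_j ρ(hol_x(p_j))_{ab}` as an observable. -/
def lineCombRe (x : Site d L) (p : σ → Word d) (c : σ → ℂ) (a b : Fin r.N) : C(GaugeConfig d L G, ℝ) :=
  ∑ j, ((c j).re • lineRe r x (p j) a b - (c j).im • lineIm r x (p j) a b)

/-- **Imaginary part of an open-string combination** `Σ_j c_j ρ(hol_x(p_j))_{ab}`. -/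
def lineCombIm (x : Site d L) (p : σ → Word d) (c : σ → ℂ) (a b : Fin r.N) : C(GaugeConfig d L G, ℝ) :=
  ∑ j, ((c j).re • lineIm r x (p j) a b + (c j).im • lineRe r x (p j) a b)

/-- `lineCombRe` evaluated: the real part of `Σ_j c_j ρ(hol_x(p_j) U)_{ab}`. -/
theorem lineCombRe_apply (x : Site d L) (p : σ → Word d) (c : σ → ℂ) (a b : Fin r.N)
    (U : GaugeConfig d L G) :
    lineCombRe r x p c a b U = (∑ j, c j * r.ρ (wordHolonomy U x (p j)) a b).re := by
  simp [lineCombRe, ContinuousMap.coe_sum, Finset.sum_apply, Complex.re_sum, Complex.mul_re]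

/-- `lineCombIm` evaluated: the imaginary part of `Σ_j c_j ρ(hol_x(p_j) U)_{ab}`. -/
theorem lineCombIm_apply (x : Site d L) (p : σ → Word d) (c : σ → ℂ) (a b : Fin r.N)
    (U : GaugeConfig d L G) :
    lineCombIm r x p c a b U = (∑ j, c j * r.ρ (wordHolonomy U x (p j)) a b).im := by
  simp [lineCombIm, ContinuousMap.coe_sum, Finset.sum_apply, Complex.im_sum, Complex.mul_im]

/-- `lineCombRe ∈ polyAlgebra`. -/
theorem lineCombRe_mem (x : Site d L) (p : σ → Word d) (c : σ → ℂ) (a b : Fin r.N) :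
    lineCombRe r x p c a b ∈ polyAlgebra (ι := Edge d L) (G := G) r :=
  Subalgebra.sum_mem _ fun j _ => Subalgebra.sub_mem _
    (Subalgebra.smul_mem _ (lineRe_mem r x (p j) a b) _) (Subalgebra.smul_mem _ (lineIm_mem r x (p j) a b) _)

/-- `lineCombIm ∈ polyAlgebra`. -/
theorem lineCombIm_mem (x : Site d L) (p : σ → Word d) (c : σ → ℂ) (a b : Fin r.N) :
    lineCombIm r x p c a b ∈ polyAlgebra (ι := Edge d L) (G := G) r :=
  Subalgebra.sum_mem _ fun j _ => Subalgebra.add_mem _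
    (Subalgebra.smul_mem _ (lineIm_mem r x (p j) a b) _) (Subalgebra.smul_mem _ (lineRe_mem r x (p j) a b) _)

/-- **`|Σ_j c_j ρ(hol_x(p_j))_{ab}|² = (Re)² + (Im)²`** pointwise, as a complex number:
`↑((lineCombRe)² + (lineCombIm)²)(U) = f(U) · conj f(U)`. -/
theorem lineComb_normSq_apply (x : Site d L) (p : σ → Word d) (c : σ → ℂ) (a b : Fin r.N)
    (U : GaugeConfig d L G) :
    (((lineCombRe r x p c a b * lineCombRe r x p c a b + lineCombIm r x p c a b * lineCombIm r x p c a b :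
        C(GaugeConfig d L G, ℝ)) U : ℝ) : ℂ) =
      (∑ j, c j * r.ρ (wordHolonomy U x (p j)) a b) * conj (∑ j, c j * r.ρ (wordHolonomy U x (p j)) a b) := by
  rw [ContinuousMap.add_apply, ContinuousMap.mul_apply, ContinuousMap.mul_apply, lineCombRe_apply,
    lineCombIm_apply, Complex.mul_conj, Complex.normSq_apply]

end Poly

end Summit.QuantumFields.GaugeBoot

end
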